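import Summits.BirchSwinnertonDyer.BirchSwinnertonDyer.Theorems.AlignedTransportAtTwoMainConjectureTransportAlignedAtTwoHalfPeriodOrdering
import Summits.BirchSwinnertonDyer.Rank1Residual.F1Sign2.AnalyticLineTransferAtTwo
import HarnessLib

/-!
# Crux C1 `MainConjectureTransportAlignedAtTwo` (stmt-BirchSwinnertonDyer-22296), line `birth`, plan «deltapos-galois» step (G2, archimedean core):
# THE LEAST REAL ROOT OF THE `u`-CUBIC IS `4·℘(iΩ₀'/2) − b₂/3` — `AlignedAtInfinity` read on the Néron lattice (lead att-p1 g10; `--supports 22296`)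

THEOREMS ONLY (no `def`, no `sorry`, no named fact). BSD is not proved by this; C1 is not closed by this.

Context (`Cruxes/MainConjectureTransportAlignedAtTwo/Lines/birth-deltapos-galois-plan.md`, file (G2)). The crux's `AlignedAtInfinity F c₁ c₂ e₁ e₂`
(`cᵢ = twoDivisionUCubic Wᵢ = u³ + b₂u² + 8b₄u + 16b₆`, `u = 4x`) says: under every real embedding `σ` of `F`, `σ e₁` is the LEAST real root of `c₁`
iff `σ e₂` is the least real root of `c₂` — in the wording `∀ x : ℝ, aeval x cᵢ = 0 → σ eᵢ ≤ x`. This file identifies that least root on the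
Néron lattice of a parametrisation datum `D` (`Δ(W) > 0`, rectangular real lattice `D.L`): with `w = iΩ₀'/2` the imaginary half-period,
* `aeval_twoDivisionUCubic_real_eq` — the substitution `u = 4t − b₂/3` turns the `u`-cubic into `16·(4t³ − g₂t − g₃)` with the Néron invariants
  `g₂ = c₄/12`, `g₃ = c₆/216` of `D.L` (`D.neronLattice_g₂/g₃`);
* **`aeval_leastRoot_eq_zero`**, **`leastRoot_le_of_aeval_eq_zero`** — `u* := 4·re ℘(w) − b₂/3` is a real root of the `u`-cubic and every real root is
  `≥ u*` (`…HalfPeriodOrdering`: `℘(w)` is the least root of the `℘`-cubic); dually `4·℘(Ω₀/2) − b₂/3` is the largest (`le_greatestRoot_of_aeval_eq_zero`);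
* **`leastRoot_iff`** — for a real number `s`: `(∀ x, aeval x c = 0 → s ≤ x) ∧ aeval s c = 0 ↔ s = u*` — so an `AlignedAtInfinity` clause
  «`σ e` is the least root» reads `σ e = 4·re ℘(w) − b₂/3`, i.e. `σ e / 4 = re ℘(w) − b₂/12` = the abscissa of `D.uniformize w` (`uniformize_spec`), the
  point `T*` of the line (`…HalfPeriodOrdering`, `…DeltaPosFunctional`).

References: Silverman AEC III.1 (`4x³ + b₂x² + 2b₄x + b₆ = 4℘³ − g₂℘ − g₃` at `x = ℘ − b₂/12`), VI.3.6; Lawden 1989 §6.11–§6.12; Cremona 1997 §3.7.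
-/

noncomputable section

-- justification: the `Summit.BirchSwinnertonDyer.BirchSwinnertonDyer.…` path repeats a component (route-file convention)
set_option linter.dupNamespace false
set_option autoImplicit false

open scoped ComplexConjugate
open Complex Set PeriodPair Polynomial
open Literature.NumberTheory.EllipticCurves Literature.NumberTheory.EllipticCurves.ModularForms
open Summit.BirchSwinnertonDyer.Rank1Residual.F1Sign2
open Summit.BirchSwinnertonDyer.BirchSwinnertonDyer.Theorems.AlignedTransportAtTwoHalfPeriodOrdering

namespace Summit.BirchSwinnertonDyer.BirchSwinnertonDyer.Theorems.AlignedTransportAtTwoDeltaPosLeastRoot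

variable {W : WeierstrassCurve ℚ} {N : ℕ} [NeZero N] (D : ModularParametrizationData W N)

/-- Real evaluation of the `u`-cubic. [folklore] -/
theorem aeval_twoDivisionUCubic_real (x : ℝ) :
    aeval x (twoDivisionUCubic W) = x ^ 3 + (W.b₂ : ℝ) * x ^ 2 + 8 * (W.b₄ : ℝ) * x + 16 * (W.b₆ : ℝ) := by
  simp only [twoDivisionUCubic, map_add, map_mul, map_pow, aeval_X, aeval_C, eq_ratCast]
  push_cast
  ring

/-- **The substitution `u = 4t − b₂/3`**: `c(4t − b₂/3) = 16·(4t³ − g₂t − g₃)` with the Néron invariants `g₂ = c₄/12`, `g₃ = c₆/216` of the lattice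
`D.L` (Silverman AEC III.1: `c₄ = b₂² − 24b₄`, `c₆ = −b₂³ + 36b₂b₄ − 216b₆`). [cite: SilvermanAEC2009, III.1 and VI.3.6] -/
theorem aeval_twoDivisionUCubic_real_eq (t : ℝ) :
    aeval (4 * t - (W.b₂ : ℝ) / 3) (twoDivisionUCubic W) = 16 * (4 * t ^ 3 - D.L.g₂.re * t - D.L.g₃.re) := by
  rw [aeval_twoDivisionUCubic_real, D.neronLattice_g₂, D.neronLattice_g₃, Complex.ofReal_re, Complex.ofReal_re]
  simp only [WeierstrassCurve.c₄, WeierstrassCurve.c₆]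
  push_cast
  ring

/-- **`u* = 4·re ℘(w) − b₂/3` is a real root of the `u`-cubic** (`w = iΩ₀'/2` the imaginary half-period of `D.L`; `℘(w)` is a root of the `℘`-cubic).
[cite: Lawden1989, §6.11] -/
theorem aeval_leastRoot_eq_zero :
    aeval (4 * (℘[D.L] (I * ((((D.L.mulLeft I I_ne_zero).minRealPeriod / 2 : ℝ)) : ℂ))).re - (W.b₂ : ℝ) / 3) (twoDivisionUCubic W) = 0 := by
  rw [aeval_twoDivisionUCubic_real_eq D, weierstrassP_halfPeriodI D.isReal_neronLattice, Complex.ofReal_re,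
    cubic_halfPeriodI_eq_zero D.isReal_neronLattice, mul_zero]

/-- **Every real root of the `u`-cubic is `≥ u*`** when `Δ(W) > 0`… in fact for any sign: `t = x/4 + b₂/12` is a real root of the `℘`-cubic, hence
`≥ ℘(w)` (`…HalfPeriodOrdering.halfPeriodI_le_of_cubic_eq_zero`). [cite: Lawden1989, §6.11] -/
theorem leastRoot_le_of_aeval_eq_zero {x : ℝ} (hx : aeval x (twoDivisionUCubic W) = 0) :
    4 * (℘[D.L] (I * ((((D.L.mulLeft I I_ne_zero).minRealPeriod / 2 : ℝ)) : ℂ))).re - (W.b₂ : ℝ) / 3 ≤ x := by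
  set t : ℝ := x / 4 + (W.b₂ : ℝ) / 12 with ht
  have hxt : x = 4 * t - (W.b₂ : ℝ) / 3 := by rw [ht]; ring
  rw [hxt, aeval_twoDivisionUCubic_real_eq D] at hx
  have ht0 : 4 * t ^ 3 - D.L.g₂.re * t - D.L.g₃.re = 0 := by linarith
  have hle := halfPeriodI_le_of_cubic_eq_zero D.isReal_neronLattice ht0
  rw [weierstrassP_halfPeriodI D.isReal_neronLattice, Complex.ofReal_re, hxt]
  linarith

/-- **Every real root of the `u`-cubic is `≤ 4·℘(Ω₀/2) − b₂/3`** (the largest root: the identity-component `2`-torsion point).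
[cite: Lawden1989, §6.11] -/
theorem le_greatestRoot_of_aeval_eq_zero {x : ℝ} (hx : aeval x (twoDivisionUCubic W) = 0) :
    x ≤ 4 * D.L.weierstrassPRe (D.L.minRealPeriod / 2) - (W.b₂ : ℝ) / 3 := by
  set t : ℝ := x / 4 + (W.b₂ : ℝ) / 12 with ht
  have hxt : x = 4 * t - (W.b₂ : ℝ) / 3 := by rw [ht]; ring
  rw [hxt, aeval_twoDivisionUCubic_real_eq D] at hx
  have ht0 : 4 * t ^ 3 - D.L.g₂.re * t - D.L.g₃.re = 0 := by linarith
  have hle := le_weierstrassPRe_half_of_cubic_eq_zero D.isReal_neronLattice ht0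
  rw [hxt]; linarith

/-- **Characterisation of the least root** (the shape of an `AlignedAtInfinity` clause): a real number `s` is a root of the `u`-cubic lying below all
real roots iff `s = 4·re ℘(w) − b₂/3`. [cite: Lawden1989, §6.11–§6.12] -/
theorem leastRoot_iff (s : ℝ) :
    (aeval s (twoDivisionUCubic W) = 0 ∧ ∀ x : ℝ, aeval x (twoDivisionUCubic W) = 0 → s ≤ x) ↔
      s = 4 * (℘[D.L] (I * ((((D.L.mulLeft I I_ne_zero).minRealPeriod / 2 : ℝ)) : ℂ))).re - (W.b₂ : ℝ) / 3 := by
  constructor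
  · rintro ⟨hs, hmin⟩
    exact le_antisymm (hmin _ (aeval_leastRoot_eq_zero D)) (leastRoot_le_of_aeval_eq_zero D hs)
  · rintro rfl
    exact ⟨aeval_leastRoot_eq_zero D, fun x hx ↦ leastRoot_le_of_aeval_eq_zero D hx⟩

/-- **The least root and the abscissa of `T* = u(w)`**: `u*/4 = re ℘(w) − b₂/12`, the abscissa `℘(w) − b₂/12` of `D.uniformize w` (`uniformize_spec`).
[cite: SilvermanAEC2009, VI.3.6] -/
theorem leastRoot_div_four :
    (4 * (℘[D.L] (I * ((((D.L.mulLeft I I_ne_zero).minRealPeriod / 2 : ℝ)) : ℂ))).re - (W.b₂ : ℝ) / 3) / 4 =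
      (℘[D.L] (I * ((((D.L.mulLeft I I_ne_zero).minRealPeriod / 2 : ℝ)) : ℂ))).re - (W.b₂ : ℝ) / 12 := by
  ring

/-- **`AlignedAtInfinity` on the Néron lattices.** For two data `D₁ D₂` (curves `W₁ W₂`), a cubic field `F` with roots `e₁ e₂` of the two `u`-cubics,
`AlignedAtInfinity F c₁ c₂ e₁ e₂`, and a real embedding `σ : F →+* ℝ` with `σ e₁ = 4·re ℘₁(w₁) − b₂(W₁)/3` (the least root of `c₁`), also
`σ e₂ = 4·re ℘₂(w₂) − b₂(W₂)/3` (the least root of `c₂`) — PROVIDED `σ e₂` is a root of `c₂` (automatic for a root `e₂ ∈ F`, `aeval_algHom`-transport,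
supplied here as the hypothesis `he₂σ` to keep the statement elementary). [cite: Lawden1989, §6.11–§6.12] -/
theorem alignedAtInfinity_leastRoot {W₁ W₂ : WeierstrassCurve ℚ} {N₁ N₂ : ℕ} [NeZero N₁] [NeZero N₂]
    (D₁ : ModularParametrizationData W₁ N₁) (D₂ : ModularParametrizationData W₂ N₂)
    {F : Type} [Field F] (e₁ e₂ : F) (hA : AlignedAtInfinity F (twoDivisionUCubic W₁) (twoDivisionUCubic W₂) e₁ e₂)
    (σ : F →+* ℝ) (he₂σ : aeval (σ e₂) (twoDivisionUCubic W₂) = 0)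
    (hσ₁ : σ e₁ = 4 * (℘[D₁.L] (I * ((((D₁.L.mulLeft I I_ne_zero).minRealPeriod / 2 : ℝ)) : ℂ))).re - (W₁.b₂ : ℝ) / 3) :
    σ e₂ = 4 * (℘[D₂.L] (I * ((((D₂.L.mulLeft I I_ne_zero).minRealPeriod / 2 : ℝ)) : ℂ))).re - (W₂.b₂ : ℝ) / 3 := by
  have h1 : ∀ x : ℝ, aeval x (twoDivisionUCubic W₁) = 0 → σ e₁ ≤ x := fun x hx ↦ by
    rw [hσ₁]; exact leastRoot_le_of_aeval_eq_zero D₁ hx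
  have h2 : ∀ x : ℝ, aeval x (twoDivisionUCubic W₂) = 0 → σ e₂ ≤ x := (hA σ).mp h1
  exact ((leastRoot_iff D₂ (σ e₂)).mp ⟨he₂σ, h2⟩)

end Summit.BirchSwinnertonDyer.BirchSwinnertonDyer.Theorems.AlignedTransportAtTwoDeltaPosLeastRoot

end
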